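import Literature.AlgebraicGeometry.Motives.AbelianVarietyCohomologyExteriorH1
import Literature.AlgebraicGeometry.HodgeTheory.WeilTypeOfQuaternionAction
import HarnessLib

/-!
# Ring 2 · AbelianAll (seat `ab-weil-2`, gen 2) — Rosati closure on `H²`: a polarization class compatible
with two anticommuting generators of a quaternion order is compatible with every pure element

HONEST FRAMING (sub-cell `pub-hodge-ring2-ab-*`, verbatim): research route, not a corollary; conditional on HC_CM plus
one named minimal statement. (Cell `pub-hodge-ring2`, verbatim: research route conditional on HC_CM; not a corollary;
Q11.4-sentence-2 already refuted in dim ≥ 3.) THIS FILE uses no hypothesis of the cell (`HC_CM`, `B_min`) and NO named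
fact: it is unconditional linear algebra on the real carriers `Hᵏ(A(ℂ); ℂ) = complexBetti A.X k` of a complex abelian
variety `A`, and is the first of three files (`…QuaternionPolarization`, `…QuaternionLagrangian`,
`…TypeIIIFourfoldsKernel`) that turn LEMMA R1 of seat `ab-weil-2` (gen 1, `Theorems/Ring2AbelianAllTypeIIIFourfolds`:
"every simple abelian fourfold of type III(1) carries a discriminant-1 Weil structure", there a typed HYPOTHESIS
`QuaternionFourfoldDichotomy`, refereed SOUND twice but DERIVED) into a KERNEL THEOREM.

WHAT IS PROVED HERE. Let `φ, ψ : A ⟶ A` with `φ ≫ φ = -d`, `ψ ≫ ψ = -e` (`d, e ≥ 1`) and `φ ≫ ψ = -(ψ ≫ φ)` — two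
anticommuting pure generators of a definite quaternion order `ℤ⟨φ, ψ⟩ ≅ ℤ⟨i, j⟩ ⊂ (-d, -e)_ℚ ↪ End⁰(A)` — and let
`L ∈ H²(A(ℂ); ℂ)` be ANY class with `φ^* L = d·L` and `ψ^* L = e·L`. Then for all integers `a, b, c` the pure element
`θ = a·φ + b·ψ + c·φψ` (with `θ ≫ θ = -m`, `m = a²d + b²e + c²de`, the tree's `pure_comp_pure_eq`) satisfies
**`θ^* L = m · L`** (`complexBetti_map_pure_two_eq_smul`). For the class `L = c₁` of a polarization this is the
statement "if the Rosati involution of `L` is quaternion conjugation on the generators `φ, ψ`, it is quaternion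
conjugation on the whole order" (`x ↦ x'` is an anti-involution, so `{x : x' = x̄}` is a subalgebra; Mumford §20–§21,
Birkenhake–Lange §5.1, §5.5: for type III the Rosati involution IS the canonical involution); here it is proved
WITHOUT a Riemann form, Rosati involution or Néron–Severi group — none of which the carriers have — by a small operator
calculus on `H²`:

* `derivTwo u := (𝟙 + u)^* - id - u^*` on `H²` (§1) acts on products of degree-one classes as the DERIVATION
  `D_u(x ⌣ y) = u^*x ⌣ y + x ⌣ u^*y` (`(f + g)^* = f^* + g^*` on `H¹`, the tree's `complexBetti_map_add_one`, and
  `u^*(x ⌣ y) = u^*x ⌣ u^*y`); since `H²(A(ℂ); ℂ)` is SPANNED by such products (`H• = ⋀• H¹`, the tree's DISCHARGED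
  fact `abelianVarietyCohomologyExteriorH1_holds`, Lange–Birkenhake Lemma 1.1.17), operator identities may be checked
  on them (§1 `linearMap_ext_of_cup`): `D_{u+v} = D_u + D_v`, `D_u ∘ D_u = 2·u^* - 2n` and `u^* ∘ D_u = -n·D_u` when
  `u ≫ u = -n`, and `[D_u, D_v] = D_{u ≫ v} - D_{v ≫ u}` (§2);
* hence (§3) for `u ≫ u = -n`, `n ≥ 1`: **`u^* L = n·L ⟺ D_u L = 0`** (⟸: `2u^*L - 2nL = D_u² L = 0`; ⟹: `M := D_u L`
  has `u^* M = -n M` and `D_u M = 0`, so `-4n·M = D_u² M = 0`); the set `{u : D_u L = 0}` is closed under `ℤ`-linear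
  combinations and under `u ≫ v - v ≫ u`; with `φ ≫ ψ - ψ ≫ φ = 2 φψ` this gives `D_θ L = 0`, i.e. `θ^* L = m L` (§4).

Consumers: `Theorems/Ring2AbelianAllTypeIIIFourfoldsKernel` (the `k`-symmetrised hyperplane class `m·L + θ^*L` of
the hyperbolic `k = ℚ(θ)` found by `…QuaternionLagrangian` is `2m·L`, so hyperbolicity for `L` is hyperbolicity for
it: `Motives.isHyperbolicWeilType_smul_iff`).

## References

* [MumfordAV1970] D. Mumford, Abelian Varieties (1970), §20 (Rosati involution `E(φx, y) = E(x, φ'y)`), §21 Thm. 2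
  (Albert: type III — totally definite quaternion algebra with the STANDARD involution).
* [LangeBirkenhake1992] H. Lange, Ch. Birkenhake, Complex Abelian Varieties (1992), Lemma 1.1.17 (`H• = ⋀• H¹`),
  §5.1 (Rosati), Prop. 5.5.7 / §5.5 (types).
* [vanGeemenVerra2003QuaternionicPryms] B. van Geemen, A. Verra, Topology 42 (2003) = math/0103111, §1.1, Lemma 4.5.
* [Hatcher2002] A. Hatcher, Algebraic Topology (2002), Prop. 3.10 (naturality of cup product).
-/

set_option linter.dupNamespace false

noncomputable section

open CategoryTheory
open Literature.AlgebraicTopology.SingularHomology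
open Literature.AlgebraicGeometry Literature.AlgebraicGeometry.HodgeTheory
open Literature.AlgebraicGeometry.Motives

namespace Summit.HodgeConjecture.HodgeConjecture.Ring2.AbelianAll

variable {A : AbelianVariety ℂ}

/-! ## §1 Pull-backs on `H¹`, `H²` as linear maps; the derivation `D_u`; extension from products -/

/-- `u^*` on `H¹(A(ℂ); ℂ)` as a `ℂ`-linear map. [cite: LangeBirkenhake1992, §1.1 (p. 19)] -/
abbrev pbOne (u : A ⟶ A) : complexBetti A.X 1 →ₗ[ℂ] complexBetti A.X 1 := (complexBetti.map u.hom.hom.hom 1).hom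

/-- `u^*` on `H²(A(ℂ); ℂ)` as a `ℂ`-linear map. [cite: LangeBirkenhake1992, §1.1 (p. 19)] -/
abbrev pbTwo (u : A ⟶ A) : complexBetti A.X 2 →ₗ[ℂ] complexBetti A.X 2 := (complexBetti.map u.hom.hom.hom 2).hom

/-- The cup product of two degree-one classes (degree `1 + 1 = 2`). [cite: Hatcher2002, §3.2] -/
abbrev cup11 (x y : complexBetti A.X 1) : complexBetti A.X 2 := cupProduct (rfl : 1 + 1 = 2) x y

/-- **The derivation `D_u := (𝟙 + u)^* - id - u^*` on `H²(A(ℂ); ℂ)`** attached to an endomorphism `u` (on products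
of degree-one classes: `D_u(x ⌣ y) = u^*x ⌣ y + x ⌣ u^*y`, `derivTwo_cup`); the transpose, under `H² ≅ Alt²(H₁)`, of
`E ↦ E(u·, ·) + E(·, u·)`. [cite: MumfordAV1970, §20] -/
def derivTwo (u : A ⟶ A) : complexBetti A.X 2 →ₗ[ℂ] complexBetti A.X 2 :=
  pbTwo (𝟙 A + u) - LinearMap.id - pbTwo u

/-- `u^*(x ⌣ y) = u^*x ⌣ u^*y` (pull-back is a ring homomorphism). [cite: Hatcher2002, Prop. 3.10] -/
theorem pbTwo_cup (u : A ⟶ A) (x y : complexBetti A.X 1) :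
    pbTwo u (cup11 x y) = cup11 (pbOne u x) (pbOne u y) :=
  cupProduct_map _ _ x y

/-- `(u + v)^* = u^* + v^*` on `H¹` (the tree's `complexBetti_map_add_one`, as linear maps).
[cite: LangeBirkenhake1992, §1.1 (p. 19)] -/
theorem pbOne_add (u v : A ⟶ A) : pbOne (u + v) = pbOne u + pbOne v := by
  change (complexBetti.map (u + v).hom.hom.hom 1).hom = _
  rw [complexBetti_map_add_one, ModuleCat.hom_add]

/-- `(n • u)^* = n • u^*` on `H¹`, `n : ℤ`. [cite: LangeBirkenhake1992, §1.1 (p. 19)] -/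
theorem pbOne_zsmul (n : ℤ) (u : A ⟶ A) : pbOne (n • u) = (n : ℂ) • pbOne u := by
  change (complexBetti.map (n • u).hom.hom.hom 1).hom = _
  rw [complexBetti_map_zsmul_one, ModuleCat.hom_zsmul, Int.cast_smul_eq_zsmul]

/-- `(-u)^* = -u^*` on `H¹`. [cite: LangeBirkenhake1992, §1.1 (p. 19)] -/
theorem pbOne_neg (u : A ⟶ A) : pbOne (-u) = -pbOne u := by
  change (complexBetti.map (-u).hom.hom.hom 1).hom = _
  rw [complexBetti_map_neg_one, ModuleCat.hom_neg]

/-- `𝟙^* = id` on `Hᵏ`. [cite: Hatcher2002, Prop. 3.10] -/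
theorem pbOne_id : pbOne (𝟙 A) = LinearMap.id := by
  change (complexBetti.map (𝟙 A.X) 1).hom = _
  rw [complexBetti.map_id]
  rfl

/-- `𝟙^* = id` on `H²`. [cite: Hatcher2002, Prop. 3.10] -/
theorem pbTwo_id : pbTwo (𝟙 A) = LinearMap.id := by
  change (complexBetti.map (𝟙 A.X) 2).hom = _
  rw [complexBetti.map_id]
  rfl

/-- `(u ≫ v)^* = u^* ∘ v^*` on `H¹`. [cite: Hatcher2002, Prop. 3.10] -/
theorem pbOne_comp (u v : A ⟶ A) : pbOne (u ≫ v) = pbOne u ∘ₗ pbOne v := by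
  refine LinearMap.ext fun c => ?_
  change complexBetti.map (u ≫ v).hom.hom.hom 1 c = complexBetti.map u.hom.hom.hom 1 (complexBetti.map v.hom.hom.hom 1 c)
  rw [complexBetti_map_map_hom]

/-- `(u ≫ v)^* = u^* ∘ v^*` on `H²`. [cite: Hatcher2002, Prop. 3.10] -/
theorem pbTwo_comp (u v : A ⟶ A) : pbTwo (u ≫ v) = pbTwo u ∘ₗ pbTwo v := by
  refine LinearMap.ext fun c => ?_
  change complexBetti.map (u ≫ v).hom.hom.hom 2 c = complexBetti.map u.hom.hom.hom 2 (complexBetti.map v.hom.hom.hom 2 c)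
  rw [complexBetti_map_map_hom]

/-- `(u ≫ u)^* = -n` on `H¹` when `u ≫ u = -(n • 𝟙)`. [cite: vanGeemen1994HodgeAV, 4.9] -/
theorem pbOne_pbOne_of_sq {n : ℕ} {u : A ⟶ A} (hu : u ≫ u = -(n • 𝟙 A)) (x : complexBetti A.X 1) :
    pbOne u (pbOne u x) = -((n : ℂ) • x) :=
  complexBetti_map_map_one_of_comp_self hu x

/-- `m₂(v) = v₀ ⌣ v₁`: the iterated cup product of two degree-one classes. [cite: Hatcher2002, §3.2] -/
theorem cupPowOne_two (v : Fin 2 → complexBetti A.X 1) :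
    cupPowOne ℂ (Motives.ComplexPoints A.X) 2 v = cup11 (v 0) (v 1) := by
  rw [cupPowOne_succ, cupPowOne_one]
  rfl

/-- **Extension from products**: two linear maps out of `H²(A(ℂ); ℂ)` that agree on all products `x ⌣ y` of
degree-one classes are equal — `H²` is spanned by such products (`H• = ⋀• H¹`, the tree's discharged fact).
[cite: LangeBirkenhake1992, Lemma 1.1.17] -/
theorem linearMap_ext_of_cup {M : Type*} [AddCommGroup M] [Module ℂ M] {f g : complexBetti A.X 2 →ₗ[ℂ] M}
    (h : ∀ x y : complexBetti A.X 1, f (cup11 x y) = g (cup11 x y)) : f = g := by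
  refine LinearMap.ext_on_range
    (abelianVarietyCohomologyExteriorH1.span_range_cupPowOne abelianVarietyCohomologyExteriorH1_holds A 2)
    fun v => ?_
  rw [cupPowOne_two]
  exact h _ _

/-- **`D_u(x ⌣ y) = u^*x ⌣ y + x ⌣ u^*y`.** [cite: MumfordAV1970, §20] -/
theorem derivTwo_cup (u : A ⟶ A) (x y : complexBetti A.X 1) :
    derivTwo u (cup11 x y) = cup11 (pbOne u x) y + cup11 x (pbOne u y) := by
  simp only [derivTwo, LinearMap.sub_apply, LinearMap.id_apply, pbTwo_cup, pbOne_add, pbOne_id,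
    LinearMap.add_apply, map_add]
  abel

/-! ## §2 The operator identities -/

/-- `D_{u+v} = D_u + D_v`. [cite: MumfordAV1970, §20] -/
theorem derivTwo_add (u v : A ⟶ A) : derivTwo (u + v) = derivTwo u + derivTwo v := by
  refine linearMap_ext_of_cup fun x y => ?_
  simp only [LinearMap.add_apply, derivTwo_cup, pbOne_add, map_add, LinearMap.map_add₂]
  abel

/-- `D_{n • u} = n • D_u`, `n : ℤ`. [cite: MumfordAV1970, §20] -/
theorem derivTwo_zsmul (n : ℤ) (u : A ⟶ A) : derivTwo (n • u) = (n : ℂ) • derivTwo u := by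
  refine linearMap_ext_of_cup fun x y => ?_
  simp only [LinearMap.smul_apply, derivTwo_cup, pbOne_zsmul, map_smul, LinearMap.map_smul₂, smul_add]

/-- `D_{-u} = -D_u`. [cite: MumfordAV1970, §20] -/
theorem derivTwo_neg (u : A ⟶ A) : derivTwo (-u) = -derivTwo u := by
  refine linearMap_ext_of_cup fun x y => ?_
  simp only [LinearMap.neg_apply, derivTwo_cup, pbOne_neg, map_neg, LinearMap.map_neg₂]
  abel

/-- `D_{u-v} = D_u - D_v`. [cite: MumfordAV1970, §20] -/
theorem derivTwo_sub (u v : A ⟶ A) : derivTwo (u - v) = derivTwo u - derivTwo v := by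
  rw [sub_eq_add_neg, derivTwo_add, derivTwo_neg, sub_eq_add_neg]

/-- **`D_u ∘ D_u = 2·u^* - 2n`** on `H²` when `u ≫ u = -(n • 𝟙)`:
`D_u²(x ⌣ y) = (u²)^*x ⌣ y + 2 u^*x ⌣ u^*y + x ⌣ (u²)^*y`. [cite: MumfordAV1970, §20] -/
theorem derivTwo_comp_derivTwo_of_sq {n : ℕ} {u : A ⟶ A} (hu : u ≫ u = -(n • 𝟙 A)) :
    derivTwo u ∘ₗ derivTwo u = (2 : ℂ) • pbTwo u - (2 * (n : ℂ)) • LinearMap.id := by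
  refine linearMap_ext_of_cup fun x y => ?_
  simp only [LinearMap.comp_apply, derivTwo_cup, map_add, LinearMap.sub_apply, LinearMap.smul_apply,
    LinearMap.add_apply, LinearMap.id_apply, pbTwo_cup, pbOne_pbOne_of_sq hu, map_neg, LinearMap.map_neg₂,
    map_smul, mul_smul, two_smul]
  abel

/-- **`u^* ∘ D_u = -n · D_u`** on `H²` when `u ≫ u = -(n • 𝟙)`. [cite: MumfordAV1970, §20] -/
theorem pbTwo_comp_derivTwo_of_sq {n : ℕ} {u : A ⟶ A} (hu : u ≫ u = -(n • 𝟙 A)) :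
    pbTwo u ∘ₗ derivTwo u = -((n : ℂ) • derivTwo u) := by
  refine linearMap_ext_of_cup fun x y => ?_
  simp only [LinearMap.comp_apply, derivTwo_cup, map_add, pbTwo_cup, pbOne_pbOne_of_sq hu, LinearMap.neg_apply,
    LinearMap.smul_apply, map_neg, LinearMap.map_neg₂, map_smul, smul_add]
  abel

/-- **`[D_u, D_v] = D_{u ≫ v} - D_{v ≫ u}`** on `H²` (with `(u ≫ v)^* = u^* ∘ v^*`). [cite: MumfordAV1970, §20] -/
theorem derivTwo_comm (u v : A ⟶ A) :
    derivTwo u ∘ₗ derivTwo v - derivTwo v ∘ₗ derivTwo u = derivTwo (u ≫ v) - derivTwo (v ≫ u) := by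
  refine linearMap_ext_of_cup fun x y => ?_
  simp only [LinearMap.sub_apply, LinearMap.comp_apply, derivTwo_cup, map_add, pbOne_comp]
  abel

/-! ## §3 `u^* L = n·L ⟺ D_u L = 0` for `u ≫ u = -n`, `n ≥ 1` -/

/-- **`u^* L = n·L ⟹ D_u L = 0`** (`u ≫ u = -(n • 𝟙)`, `n ≥ 1`): `M := D_u L` satisfies `u^* M = -n M` and
`D_u M = 2u^*L - 2nL = 0`, hence `-4n M = D_u² M = 0`. In Riemann-form language: `E(ux, uy) = n E(x, y)` forces
`E(ux, y) = E(x, ū y)`, `ū = -u`. [cite: MumfordAV1970, §20] -/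
theorem derivTwo_apply_eq_zero_of_pbTwo_eq_smul {n : ℕ} (hn : 0 < n) {u : A ⟶ A} (hu : u ≫ u = -(n • 𝟙 A))
    {L : complexBetti A.X 2} (hL : pbTwo u L = (n : ℂ) • L) : derivTwo u L = 0 := by
  set M := derivTwo u L with hM
  have h1 : derivTwo u M = 0 := by
    have h := congrArg (fun f => f L) (derivTwo_comp_derivTwo_of_sq hu)
    simp only [LinearMap.comp_apply, LinearMap.sub_apply, LinearMap.smul_apply, LinearMap.id_apply, hL,
      smul_smul, sub_self] at h
    exact h
  have h2 : pbTwo u M = -((n : ℂ) • M) := by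
    have h := congrArg (fun f => f L) (pbTwo_comp_derivTwo_of_sq hu)
    simpa only [LinearMap.comp_apply, LinearMap.neg_apply, LinearMap.smul_apply] using h
  have h3 : (2 : ℂ) • pbTwo u M - (2 * (n : ℂ)) • M = 0 := by
    have h := congrArg (fun f => f M) (derivTwo_comp_derivTwo_of_sq hu)
    simp only [LinearMap.comp_apply, LinearMap.sub_apply, LinearMap.smul_apply, LinearMap.id_apply, h1,
      map_zero] at h
    exact h.symm
  rw [h2, smul_neg, smul_smul, ← neg_smul, ← sub_smul] at h3
  have h4 : (-(2 * (n : ℂ)) - 2 * (n : ℂ)) ≠ 0 := by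
    have : (n : ℂ) ≠ 0 := Nat.cast_ne_zero.2 hn.ne'
    intro h0
    apply this
    linear_combination (-1 / 4 : ℂ) * h0
  exact (smul_eq_zero.1 h3).resolve_left h4

/-- **`D_u L = 0 ⟹ u^* L = n·L`** (`u ≫ u = -(n • 𝟙)`): `2u^*L - 2nL = D_u(D_u L) = 0`. [cite: MumfordAV1970, §20] -/
theorem pbTwo_eq_smul_of_derivTwo_apply_eq_zero {n : ℕ} {u : A ⟶ A} (hu : u ≫ u = -(n • 𝟙 A))
    {L : complexBetti A.X 2} (hD : derivTwo u L = 0) : pbTwo u L = (n : ℂ) • L := by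
  have h := congrArg (fun f => f L) (derivTwo_comp_derivTwo_of_sq hu)
  simp only [LinearMap.comp_apply, LinearMap.sub_apply, LinearMap.smul_apply, LinearMap.id_apply, hD,
    map_zero] at h
  have h2 : (2 : ℂ) • (pbTwo u L - (n : ℂ) • L) = 0 := by
    rw [smul_sub, smul_smul]; exact h.symm
  rw [smul_eq_zero] at h2
  exact sub_eq_zero.1 (h2.resolve_left two_ne_zero)

/-- `D_{u ≫ v} L = 0` from `D_u L = D_v L = 0` when `u, v` ANTICOMMUTE (`u ≫ v - v ≫ u = 2·(u ≫ v)` and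
`[D_u, D_v] = D_{u≫v} - D_{v≫u}`): the Rosati-type condition is closed under the quaternion product of anticommuting
pure elements. [cite: MumfordAV1970, §20] [cite: vanGeemenVerra2003QuaternionicPryms, §1.1] -/
theorem derivTwo_comp_apply_eq_zero_of_anticomm {u v : A ⟶ A} (h : u ≫ v = -(v ≫ u)) {L : complexBetti A.X 2}
    (hu : derivTwo u L = 0) (hv : derivTwo v L = 0) : derivTwo (u ≫ v) L = 0 := by
  have hc := congrArg (fun f => f L) (derivTwo_comm u v)
  simp only [LinearMap.sub_apply, LinearMap.comp_apply, hu, hv, map_zero, sub_zero] at hc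
  have h2 : v ≫ u = -(u ≫ v) := by rw [h, neg_neg]
  rw [h2, derivTwo_neg, LinearMap.neg_apply, sub_neg_eq_add, ← two_smul ℂ] at hc
  exact (smul_eq_zero.1 hc.symm).resolve_left two_ne_zero

/-! ## §4 Main theorem: compatibility with the generators gives compatibility with every pure element -/

variable {φ ψ : A ⟶ A} {d e : ℕ}

/-- **ROSATI CLOSURE ON `H²`.** Let `φ ≫ φ = -d`, `ψ ≫ ψ = -e` (`d, e ≥ 1`), `φ ≫ ψ = -(ψ ≫ φ)`, and let `L ∈ H²(A(ℂ); ℂ)`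
satisfy `φ^* L = d·L`, `ψ^* L = e·L`. Then for all `a, b, c : ℤ` and `m` with `m = a²d + b²e + c²de` the pure element
`θ = a·φ + b·ψ + c·φψ` (`θ ≫ θ = -m`, `pure_comp_pure_eq`) satisfies `θ^* L = m·L`. (For `L` a polarization class of a
simple type III abelian variety this is "the Rosati involution is the canonical involution on the whole order", Mumford
§21 Thm. 2; proved here from the two generators by the derivation calculus, for ANY class `L`.)
[cite: MumfordAV1970, §20 and §21 Thm. 2] [cite: vanGeemenVerra2003QuaternionicPryms, §1.1] -/
theorem pbTwo_pure_eq_smul (hd : 0 < d) (he : 0 < e) (hφ : φ ≫ φ = -(d • 𝟙 A)) (hψ : ψ ≫ ψ = -(e • 𝟙 A))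
    (h : φ ≫ ψ = -(ψ ≫ φ)) {L : complexBetti A.X 2} (hφL : pbTwo φ L = (d : ℂ) • L)
    (hψL : pbTwo ψ L = (e : ℂ) • L) (a b c : ℤ) {m : ℕ} (hm : (m : ℤ) = a ^ 2 * d + b ^ 2 * e + c ^ 2 * (d * e)) :
    pbTwo (a • φ + b • ψ + c • (φ ≫ ψ)) L = (m : ℂ) • L := by
  have hDφ := derivTwo_apply_eq_zero_of_pbTwo_eq_smul hd hφ hφL
  have hDψ := derivTwo_apply_eq_zero_of_pbTwo_eq_smul he hψ hψL
  have hDφψ := derivTwo_comp_apply_eq_zero_of_anticomm h hDφ hDψ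
  refine pbTwo_eq_smul_of_derivTwo_apply_eq_zero (pure_comp_pure_eq hφ hψ h a b c hm) ?_
  simp only [derivTwo_add, derivTwo_zsmul, LinearMap.add_apply, LinearMap.smul_apply, hDφ, hDψ, hDφψ, smul_zero,
    add_zero]

/-- The same on the carriers' own terms (`complexBetti.map … 2`), for consumers.
[cite: MumfordAV1970, §20 and §21 Thm. 2] -/
theorem complexBetti_map_pure_two_eq_smul (hd : 0 < d) (he : 0 < e) (hφ : φ ≫ φ = -(d • 𝟙 A))
    (hψ : ψ ≫ ψ = -(e • 𝟙 A)) (h : φ ≫ ψ = -(ψ ≫ φ)) {L : complexBetti A.X 2}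
    (hφL : complexBetti.map φ.hom.hom.hom 2 L = (d : ℂ) • L) (hψL : complexBetti.map ψ.hom.hom.hom 2 L = (e : ℂ) • L)
    (a b c : ℤ) {m : ℕ} (hm : (m : ℤ) = a ^ 2 * d + b ^ 2 * e + c ^ 2 * (d * e)) :
    complexBetti.map (a • φ + b • ψ + c • (φ ≫ ψ)).hom.hom.hom 2 L = (m : ℂ) • L :=
  pbTwo_pure_eq_smul hd he hφ hψ h hφL hψL a b c hm

/-- In particular the `k`-SYMMETRISED class of `L` for `k = ℚ(θ)` is `2m · L`:
`m·L + θ^*L = (2m)·L`. [cite: vanGeemen1994HodgeAV, Lemma 5.2] -/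
theorem symmetrised_pure_eq_smul (hd : 0 < d) (he : 0 < e) (hφ : φ ≫ φ = -(d • 𝟙 A))
    (hψ : ψ ≫ ψ = -(e • 𝟙 A)) (h : φ ≫ ψ = -(ψ ≫ φ)) {L : complexBetti A.X 2}
    (hφL : complexBetti.map φ.hom.hom.hom 2 L = (d : ℂ) • L) (hψL : complexBetti.map ψ.hom.hom.hom 2 L = (e : ℂ) • L)
    (a b c : ℤ) {m : ℕ} (hm : (m : ℤ) = a ^ 2 * d + b ^ 2 * e + c ^ 2 * (d * e)) :
    (m : ℂ) • L + complexBetti.map (a • φ + b • ψ + c • (φ ≫ ψ)).hom.hom.hom 2 L = (2 * (m : ℂ)) • L := by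
  rw [complexBetti_map_pure_two_eq_smul hd he hφ hψ h hφL hψL a b c hm, ← add_smul, two_mul]

end Summit.HodgeConjecture.HodgeConjecture.Ring2.AbelianAll

end
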